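import Summits.QuantumFields.BalabanUV.T4Continuum.Support.NE7SliceIterationOrbit
import HarnessLib

/-!
# NE7SliceIterationOrbitWeighted — THE (S1) ORBIT THEOREM WITH THE k-UNIFORM TWO-RADIUS WORKING REGION (memo ROAD-G102 §1): gen 101's `NE7SliceIterationOrbit.slice_orbit`
# measures the state by `‖(sup‖X(u)‖, sup‖h(u)‖)‖ ≤ S` and asks `M·S ≤ τ`; but the corner logs `h(u_j)` grow to `≍ 24dM·δ₀` along the orbit (they encode the frames of the
# representative, an ABSOLUTE `O(ε)` quantity), so `M·S ≤ τ` is not uniform in `k`.  The contraction arithmetic (`NE7SliceIterationContractionArith`) only ever needs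
# `M·sup‖X‖ ≤ τ` and `sup‖h‖ ≤ τ` SEPARATELY.  THIS FILE re-runs the engine with the WEIGHTED size pair `Φ(u) := (M·sup‖X(u)‖, sup‖h(u)‖)`, region `‖Φ(u)‖ ≤ S ≤ τ`:
# the step halves the defect, moves `Φ` by `≤ 12dM·Df` and each site by `≤ 12dM·Df`, and the orbit of `u₀` converges with `‖Φ(u_j)‖ ≤ s₀ + 24dM·δ₀` — every
# hypothesis now k-uniform (`M·sup‖X(u₀)‖`, `sup‖h(u₀)‖`, `M·Df(u₀)` are the `O(ε)` currencies of the near-representative)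

Cell `pub-balaban`, rung (B)+1 sub-cell t4, lineage `b2b-balaban-t4-ne7-p1`, generation 102 (CRUX PROVER NE7 #1 = OWNER of BINDER row NE7).  Memo `t4/b2b-balaban-t4-ne7-p1-g102/ROAD-G102.md` §1.
WHAT ([folklore]; 0 def, 0 sorry).  §1 `weighted_region` (unpacking `‖(M·s, η)‖ ≤ S`), **`step_halves_defect_w`** (`Df(e^{−ζ(u)}u) ≤ Df(u)∕2` on the region `M·sup‖X(u)‖ ≤ S`,
`sup‖h(u)‖ ≤ S`, regime `S, M·δmax, M²x, M²x′ ≤ τ ≤ 1`, `30000dτ ≤ 1`, `6dM·δmax ≤ 10⁻⁴`, `S ≤ 10⁻⁴`, `cruxC·M²x ≤ 1∕2`, `3·10⁶(1+16K)(1+d)³(1+frameC)(1+supC+supCurlC)·τ ≤ 1∕2`),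
**`step_sizes_le_w`** (`‖Φ(e^{−ζ(u)}u)‖ ≤ ‖Φ(u)‖ + 12dM·Df(u)`).  §2 **`slice_orbit_w`** (statement displayed; the curved sup letter (L) is the displayed hypothesis `hLet`, discharged at
`d+1 ≥ 2` by `NE7CurvedSupLetter.curved_sup_letter`).
HONEST FRAMING (page 1): the engine run on OUR state maps; nothing of Bałaban's asserted; NOT (S1) in full (the initial state and the slice condition of the limit are separate files), NOT NE7;
spine 0∕9; finite T⁴ rung (B)+1 — NOT infinite volume, NOT mass gap, NOT BetaPertH, NOT Clay.  Continuum YM on T⁴ ⇐ BetaPertH ∧ nine spine estimates (0/9 proved); BetaPertH ⇐ (D1) ∧ (D4) ∧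
CAP+tail; G-an2-4 gates asym, D1 and NE2/3/4.
-/

set_option autoImplicit false

open scoped BigOperators Matrix.Norms.L2Operator
open NormedSpace Finset Filter Topology

namespace Summit.QuantumFields.BalabanUV.T4Continuum.NE7SliceIterationOrbitWeighted

open Literature.MathematicalPhysics.QuantumFieldTheory.Balaban1983to89
open B7Prop1Explicit B7Prop2Explicit MatrixLog
open T4AveragingDeficitWall (IsUnitaryCfg IsSkewDir SmallField vary curlAt)
open T4AveragingDeficitWallBoundary (IsPeriodicCfg periodBox)
open AveragingDeficitPeriodicCounting (IsPeriodicDir)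
open AveragingDeficitTwoLevelPrep (prop1Radius)
open AveragingDeficitMultiLevelPrep (cavgIter LevelSmall tower)
open BlockAveragePushDirGauge (gaugeDir)
open NE3EnergyShapes (IsUnitarySite IsPeriodicSite)
open NE3RightInverseSupLetters (frameC supC)
open NE3HatInvCurlLetters (supCurlC)
open NE3QbarIterCovLiftPrep (cruxC)
open NE3LinearisedAverageSup (curvSum)
open NE7MeanZeroGaugeSliceW (energyBlockLandauW)
open NE7DefectIterationCauchy (exists_orbit_limit mem_unitary_of_tendsto periodic_of_tendsto)
open SpreadLift (loopRad)
open NE7SliceIterationState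
open NE7SliceIterationStateFacts
open NE7SliceIterationStep
open NE7SliceIterationContractionArith
open NE7SliceIterationOrbit (region_sizes)

noncomputable section

variable {d : ℕ} {n : Type*} [Fintype n] [DecidableEq n]

section Orbit

variable [Nonempty n] {L : ℕ} (hL : 2 ≤ L) (k : ℕ) {W : Site d → Fin d → (Matrix n n ℂ)ˣ} {x : ℝ} (hWu : IsUnitaryCfg W) (hx : 0 ≤ x) (hs : LevelSmall d L k x)
  (hWx : SmallField W x) (N : ℕ) [NeZero N] (hθ : cruxC d L * (((L : ℝ) ^ (k + 1)) ^ 2 * x) < 1) (U' : Site d → Fin d → (Matrix n n ℂ)ˣ)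
  (hWP : IsPeriodicCfg W ((tower L N (k + 1) : ℕ) : ℤ)) (hU'u : IsUnitaryCfg U') (hU'P : IsPeriodicCfg U' ((tower L N (k + 1) : ℕ) : ℤ))

/-! ## §1 The weighted region; the step halves the defect and moves the weighted sizes little -/

omit [Nonempty n] [NeZero N] in
include hL in
/-- **UNPACKING THE WEIGHTED REGION**: `‖(M·s(u), η_h(u))‖ ≤ S` gives `M·s(u) ≤ S`, `s(u) ≤ S`, `η_h(u) ≤ S` (the size pair has nonnegative components, `M ≥ 1`). [folklore] -/
theorem weighted_region {u : Site d → (Matrix n n ℂ)ˣ} {S : ℝ}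
    (hΦ : ‖((L : ℝ) ^ (k + 1) * (sizePair (L := L) (W := W) k N U' u).1, (sizePair (L := L) (W := W) k N U' u).2)‖ ≤ S) :
    (L : ℝ) ^ (k + 1) * (sizePair (L := L) (W := W) k N U' u).1 ≤ S ∧ (sizePair (L := L) (W := W) k N U' u).1 ≤ S ∧
      (sizePair (L := L) (W := W) k N U' u).2 ≤ S := by
  have hM1 : (1 : ℝ) ≤ (L : ℝ) ^ (k + 1) := one_le_pow₀ (by exact_mod_cast (by omega : 1 ≤ L))
  have h10 : 0 ≤ (sizePair (L := L) (W := W) k N U' u).1 := bondSup_nonneg fun y μ => norm_nonneg _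
  have h20 : 0 ≤ (sizePair (L := L) (W := W) k N U' u).2 := siteSup_nonneg fun z => norm_nonneg _
  have hM10 : 0 ≤ (L : ℝ) ^ (k + 1) * (sizePair (L := L) (W := W) k N U' u).1 := mul_nonneg (by positivity) h10
  have h1 := norm_fst_le ((L : ℝ) ^ (k + 1) * (sizePair (L := L) (W := W) k N U' u).1, (sizePair (L := L) (W := W) k N U' u).2)
  have h2 := norm_snd_le ((L : ℝ) ^ (k + 1) * (sizePair (L := L) (W := W) k N U' u).1, (sizePair (L := L) (W := W) k N U' u).2)
  rw [Real.norm_of_nonneg hM10] at h1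
  rw [Real.norm_of_nonneg h20] at h2
  refine ⟨h1.trans hΦ, ?_, h2.trans hΦ⟩
  exact (le_mul_of_one_le_left h10 hM1).trans (h1.trans hΦ)

include hWP hU'u hU'P in
/-- **THE STEP HALVES THE DEFECT** on the WEIGHTED region `M·sup‖X(u)‖ ≤ S`, `sup‖h(u)‖ ≤ S`, `Df(u) ≤ δmax`, in the k-uniform regime of the header (`S ≤ τ`; no `M·S ≤ τ`). [folklore] -/
theorem step_halves_defect_w (hd : 0 < d)
    (hθP : 4 * (d : ℝ) ^ 2 * ((L : ℝ) ^ (k + 1) - 1) ^ 2 * x + 16 * d * loopRad d L ((prop1Radius d L)^[k] x)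
      + 4 * d * ((d : ℝ) - 1) * ((L : ℝ) ^ (k + 1) - 1) ^ 2 * x ≤ 1 / 2)
    {K : ℝ} (hK : 0 ≤ K) (hKε : 16 * K * d * (((L : ℝ) ^ (k + 1)) ^ 2 * x) ≤ 1 / 2)
    (hLet : ∀ Y : Site d → Fin d → Matrix n n ℂ, Y ∈ energyBlockLandauW (d := d) (n := n) L N (k + 1) W →
      ∀ B : ℝ, (∀ (z : Site d) (μ ν : Fin d), μ ≠ ν → ‖curlAt W Y z μ ν‖ ≤ B) → ∀ (y : Site d) (κ : Fin d), ‖Y y κ‖ ≤ K * (L : ℝ) ^ (k + 1) * B)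
    (hε : ((L : ℝ) ^ (k + 1)) ^ 2 * x ≤ 1) (hA : curvSum d L (k + 1) x ≤ 2 / 3 * L) (hθc : cruxC d L * (((L : ℝ) ^ (k + 1)) ^ 2 * x) ≤ 1 / 2)
    {x' : ℝ} (hx'0 : 0 ≤ x') (hU'x : SmallField U' x')
    {τ S δmax : ℝ} (hτ0 : 0 ≤ τ) (hτ1 : τ ≤ 1) (hτs : 30000 * (d : ℝ) * τ ≤ 1)
    (hC : 3000000 * (1 + 16 * K) * (1 + (d : ℝ)) ^ 3 * (1 + frameC d L) * (1 + supC d L + supCurlC d L) * τ ≤ 1 / 2)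
    (hS4 : S ≤ 1 / 10000) (hSτ : S ≤ τ)
    (hδmax : 6 * (d : ℝ) * (L : ℝ) ^ (k + 1) * δmax ≤ 1 / 10000) (hMδ : (L : ℝ) ^ (k + 1) * δmax ≤ τ)
    (h4 : ((L : ℝ) ^ (k + 1)) ^ 2 * x ≤ τ) (h5 : ((L : ℝ) ^ (k + 1)) ^ 2 * x' ≤ τ)
    {u : Site d → (Matrix n n ℂ)ˣ} (hu : IsUnitarySite u) (huP : IsPeriodicSite u ((tower L N (k + 1) : ℕ) : ℤ))
    (hgauge : gaugeAct u U' = vary W (repLog W U' u) 1)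
    (hcorner : ∀ z, ((u (((L : ℤ) ^ (k + 1)) • z) : (Matrix n n ℂ)ˣ) : Matrix n n ℂ) = exp (cornerLog L k u z))
    (hDf : sliceDefect hL k hWu hx hs hWx N hθ U' u ≤ δmax)
    (hΦ1 : (L : ℝ) ^ (k + 1) * (sizePair (L := L) (W := W) k N U' u).1 ≤ S) (hΦ2 : (sizePair (L := L) (W := W) k N U' u).2 ≤ S) :
    sliceDefect hL k hWu hx hs hWx N hθ U' (sliceStep hL k hWu hx hs hWx N hθ U' u) ≤ sliceDefect hL k hWu hx hs hWx N hθ U' u / 2 := by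
  have hM1 : (1 : ℝ) ≤ (L : ℝ) ^ (k + 1) := one_le_pow₀ (by exact_mod_cast (by omega : 1 ≤ L))
  have hd1 : (1 : ℝ) ≤ d := by exact_mod_cast hd
  obtain ⟨hX, hh, h10, -, h20, -⟩ := region_sizes hL k N U' hWP hU'P huP
  obtain ⟨a, hadef⟩ : ∃ a : ℝ, (sizePair (L := L) (W := W) k N U' u).1 = a := ⟨_, rfl⟩
  obtain ⟨b, hbdef⟩ : ∃ b : ℝ, (sizePair (L := L) (W := W) k N U' u).2 = b := ⟨_, rfl⟩
  rw [hadef] at hX h10 hΦ1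
  rw [hbdef] at hh h20 hΦ2
  clear hadef hbdef
  have hMa : (L : ℝ) ^ (k + 1) * a ≤ τ := hΦ1.trans hSτ
  have haS : a ≤ S := (le_mul_of_one_le_left h10 hM1).trans hΦ1
  have ha4 : a ≤ 1 / 10000 := haS.trans hS4
  have hb4 : b ≤ 1 / 10000 := hΦ2.trans hS4
  have hb2 : b ≤ 1 / 100 := hb4.trans (by norm_num)
  have hbτ : b ≤ τ := hΦ2.trans hSτ
  have hX8 : ∀ y κ, ‖repLog W U' u y κ‖ ≤ 1 / 8 := fun y κ => (hX y κ).trans (by linarith)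
  have hh8 : ∀ z, ‖cornerLog L k u z‖ ≤ 1 / 8 := fun z => (hh z).trans (by linarith)
  clear hΦ1 hΦ2 haS hS4 hSτ
  have hDf0 : 0 ≤ sliceDefect hL k hWu hx hs hWx N hθ U' u := sliceDefect_nonneg hL k hWu hx hs hWx N hθ U' u
  obtain ⟨D, hDdef⟩ : ∃ D : ℝ, sliceDefect hL k hWu hx hs hWx N hθ U' u = D := ⟨_, rfl⟩
  have hD0 : 0 ≤ D := hDdef ▸ hDf0
  have hDmax : D ≤ δmax := hDdef ▸ hDf
  clear hDf hDf0
  have hM0 : 0 < (L : ℝ) ^ (k + 1) := by positivity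
  have hδ : ∀ y μ, ‖gaugeDir W (gaugeFun hL k hWu hx hs hWx N hθ U' u) y μ‖ ≤ D := fun y μ =>
    hDdef ▸ ((norm_gaugeDir_gaugeFun_le hL k hWu hx hs hWx N hθ U' hWP hU'u hU'P hu huP hgauge hX8 hcorner hh8 y μ).trans
      (delta_le_sliceDefect hL k hWu hx hs hWx N hθ U' u))
  have hσ : ∀ y, ‖gaugeFun hL k hWu hx hs hWx N hθ U' u y‖ ≤ 6 * d * (L : ℝ) ^ (k + 1) * D := fun y => by
    rw [← hDdef]; exact norm_gaugeFun_le hL k hWu hx hs hWx N hθ U' hWP hU'u hU'P hu huP hgauge hX8 hcorner hh8 hd hθP y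
  have hσ0 : 0 ≤ 6 * (d : ℝ) * (L : ℝ) ^ (k + 1) * D := by positivity
  have hσ4 : 6 * (d : ℝ) * (L : ℝ) ^ (k + 1) * D ≤ 1 / 10000 := (mul_le_mul_of_nonneg_left hDmax (by positivity)).trans hδmax
  have hδ4 : D ≤ 1 / 10000 := by
    have h1 : D ≤ 6 * (d : ℝ) * (L : ℝ) ^ (k + 1) * D := by
      have : (1 : ℝ) ≤ 6 * (d : ℝ) * (L : ℝ) ^ (k + 1) := by nlinarith
      exact le_mul_of_one_le_left hD0 this
    exact h1.trans hσ4
  have hfC : 0 ≤ frameC d L := by unfold frameC; positivity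
  have hsC : 0 ≤ supC d L := by
    unfold supC NE3RightInverseSupLetters.corrC NE3RightInverseSupLetters.frameC; have := NE3QbarIterCovLiftPrep.liftC_nonneg d; positivity
  have hsCC : 0 ≤ supCurlC d L := by
    unfold supCurlC NE3RightInverseSupLetters.frameC; have := NE3QbarIterCovLiftPrep.liftC_nonneg d; positivity
  have h1θ : 0 < 1 - cruxC d L * (((L : ℝ) ^ (k + 1)) ^ 2 * x) := by linarith only [hθc]
  have heJ0 : 0 ≤ 16384 * D * a + 2048 * (6 * (d : ℝ) * (L : ℝ) ^ (k + 1) * D) * D + 6 * (6 * (d : ℝ) * (L : ℝ) ^ (k + 1) * D) * a := by positivity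
  have hec0 : 0 ≤ 4096 * (6 * (d : ℝ) * (L : ℝ) ^ (k + 1) * D) * b := by positivity
  have hφ0 : 0 ≤ (3 + 12 * (d : ℝ)) * (L : ℝ) ^ (k + 1) * (16384 * D * a + 2048 * (6 * (d : ℝ) * (L : ℝ) ^ (k + 1) * D) * D + 6 * (6 * (d : ℝ) * (L : ℝ) ^ (k + 1) * D) * a)
      + 2 * (4096 * (6 * (d : ℝ) * (L : ℝ) ^ (k + 1) * D) * b) := by
    positivity
  have heE0 : 0 ≤ (16384 * D * a + 2048 * (6 * (d : ℝ) * (L : ℝ) ^ (k + 1) * D) * D + 6 * (6 * (d : ℝ) * (L : ℝ) ^ (k + 1) * D) * a)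
      + supC d L / ((L : ℝ) ^ (k + 1) * (1 - cruxC d L * (((L : ℝ) ^ (k + 1)) ^ 2 * x)))
        * ((3 + 12 * (d : ℝ)) * (L : ℝ) ^ (k + 1) * (16384 * D * a + 2048 * (6 * (d : ℝ) * (L : ℝ) ^ (k + 1) * D) * D + 6 * (6 * (d : ℝ) * (L : ℝ) ^ (k + 1) * D) * a)
          + 2 * (4096 * (6 * (d : ℝ) * (L : ℝ) ^ (k + 1) * D) * b)) :=
    add_nonneg heJ0 (mul_nonneg (div_nonneg hsC (mul_pos hM0 h1θ).le) hφ0)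
  have hexp0 : 0 ≤ Real.exp (4 * (a + D + (16384 * D * a + 2048 * (6 * (d : ℝ) * (L : ℝ) ^ (k + 1) * D) * D + 6 * (6 * (d : ℝ) * (L : ℝ) ^ (k + 1) * D) * a))) - 1 := by
    have := Real.add_one_le_exp (4 * (a + D + (16384 * D * a + 2048 * (6 * (d : ℝ) * (L : ℝ) ^ (k + 1) * D) * D + 6 * (6 * (d : ℝ) * (L : ℝ) ^ (k + 1) * D) * a)))
    linarith only [this, heJ0, h10, hD0]
  have hcE0 : 0 ≤ (2 * (2 * (6 * (d : ℝ) * (L : ℝ) ^ (k + 1) * D)) * x'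
        + 4 * (Real.exp (4 * (a + D + (16384 * D * a + 2048 * (6 * (d : ℝ) * (L : ℝ) ^ (k + 1) * D) * D + 6 * (6 * (d : ℝ) * (L : ℝ) ^ (k + 1) * D) * a))) - 1)
          * (D + (16384 * D * a + 2048 * (6 * (d : ℝ) * (L : ℝ) ^ (k + 1) * D) * D + 6 * (6 * (d : ℝ) * (L : ℝ) ^ (k + 1) * D) * a))
        + 2 * x * (6 * (d : ℝ) * (L : ℝ) ^ (k + 1) * D))
      + supCurlC d L / (((L : ℝ) ^ (k + 1)) ^ 2 * (1 - cruxC d L * (((L : ℝ) ^ (k + 1)) ^ 2 * x)))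
        * ((3 + 12 * (d : ℝ)) * (L : ℝ) ^ (k + 1) * (16384 * D * a + 2048 * (6 * (d : ℝ) * (L : ℝ) ^ (k + 1) * D) * D + 6 * (6 * (d : ℝ) * (L : ℝ) ^ (k + 1) * D) * a)
          + 2 * (4096 * (6 * (d : ℝ) * (L : ℝ) ^ (k + 1) * D) * b)) := by
    refine add_nonneg (add_nonneg (add_nonneg (by positivity) (mul_nonneg (mul_nonneg (by norm_num) hexp0) (add_nonneg hD0 heJ0))) (by positivity))
      (mul_nonneg (div_nonneg hsCC (mul_pos (by positivity) h1θ).le) hφ0)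
  have hstep := sliceDefect_sliceStep_le hL k hWu hx hs hWx N hθ U' hWP hU'u hU'P hu huP hgauge hcorner hX ha4 hh hb2 hδ hσ hσ4 hd hθP hK hKε hLet hε hA hU'x
    h10 h20 hD0 hδ4 hσ0 heE0 hcE0 le_rfl le_rfl
  rw [hDdef]
  refine hstep.trans ?_
  obtain ⟨M, hMdef⟩ : ∃ M : ℝ, (L : ℝ) ^ (k + 1) = M := ⟨_, rfl⟩
  rw [hMdef] at hM1 hMa hδmax hMδ h4 h5 heE0 hec0 hM0 ⊢
  have hθcM : cruxC d L * (M ^ 2 * x) ≤ 1 / 2 := by rw [← hMdef]; exact hθc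
  have h2 : M * D ≤ τ := (mul_le_mul_of_nonneg_left hDmax hM0.le).trans hMδ
  have heEb := eE_le (sC := supC d L) hd1 hM1 hsC h10 h20 hD0 hθcM hτ0 hMa h2 hbτ
  have hcEb := twoKM_cE_le (sCC := supCurlC d L) hd1 hM1 hK hsCC h10 h20 hD0 hθcM hτ0 hMa h2 hbτ h4 h5 hτs
  have hecb := ecM_le hd1 hM1 hD0 hbτ (η := b) (D := D)
  exact step_bound_le_half hd1 hM1 hK hfC hsC hsCC hD0 hx hτ0 hτ1 h4 heE0 hec0 heEb hcEb hecb hC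

include hWP hU'u hU'P in
/-- **THE STEP MOVES THE WEIGHTED SIZES BY `≤ 12dM·Df(u)`** on the weighted region (`S ≤ 10⁻⁴`, `S ≤ τ`, `6dM·δmax ≤ 10⁻⁴`, `30000dτ ≤ 1`): `M·s` moves by `≤ 3M·Df`, `η_h` by `≤ 2σ ≤ 12dM·Df`.
[folklore] -/
theorem step_sizes_le_w (hd : 0 < d)
    (hθP : 4 * (d : ℝ) ^ 2 * ((L : ℝ) ^ (k + 1) - 1) ^ 2 * x + 16 * d * loopRad d L ((prop1Radius d L)^[k] x)
      + 4 * d * ((d : ℝ) - 1) * ((L : ℝ) ^ (k + 1) - 1) ^ 2 * x ≤ 1 / 2)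
    {τ S δmax : ℝ} (hτs : 30000 * (d : ℝ) * τ ≤ 1)
    (hS4 : S ≤ 1 / 10000) (hSτ : S ≤ τ)
    (hδmax : 6 * (d : ℝ) * (L : ℝ) ^ (k + 1) * δmax ≤ 1 / 10000)
    {u : Site d → (Matrix n n ℂ)ˣ} (hu : IsUnitarySite u) (huP : IsPeriodicSite u ((tower L N (k + 1) : ℕ) : ℤ))
    (hgauge : gaugeAct u U' = vary W (repLog W U' u) 1)
    (hcorner : ∀ z, ((u (((L : ℤ) ^ (k + 1)) • z) : (Matrix n n ℂ)ˣ) : Matrix n n ℂ) = exp (cornerLog L k u z))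
    (hDf : sliceDefect hL k hWu hx hs hWx N hθ U' u ≤ δmax)
    (hΦ1 : (L : ℝ) ^ (k + 1) * (sizePair (L := L) (W := W) k N U' u).1 ≤ S) (hΦ2 : (sizePair (L := L) (W := W) k N U' u).2 ≤ S) :
    ‖((L : ℝ) ^ (k + 1) * (sizePair (L := L) (W := W) k N U' (sliceStep hL k hWu hx hs hWx N hθ U' u)).1,
        (sizePair (L := L) (W := W) k N U' (sliceStep hL k hWu hx hs hWx N hθ U' u)).2)‖
      ≤ ‖((L : ℝ) ^ (k + 1) * (sizePair (L := L) (W := W) k N U' u).1, (sizePair (L := L) (W := W) k N U' u).2)‖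
        + 12 * d * (L : ℝ) ^ (k + 1) * sliceDefect hL k hWu hx hs hWx N hθ U' u := by
  haveI : NeZero L := ⟨by omega⟩
  have hP1 : 1 ≤ tower L N (k + 1) := Nat.one_le_iff_ne_zero.mpr (NeZero.ne _)
  have hN1 : 1 ≤ N := Nat.one_le_iff_ne_zero.mpr (NeZero.ne _)
  have hM1 : (1 : ℝ) ≤ (L : ℝ) ^ (k + 1) := one_le_pow₀ (by exact_mod_cast (by omega : 1 ≤ L))
  have hd1 : (1 : ℝ) ≤ d := by exact_mod_cast hd
  obtain ⟨hX, hh, h10, -, h20, -⟩ := region_sizes hL k N U' hWP hU'P huP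
  obtain ⟨a, hadef⟩ : ∃ a : ℝ, (sizePair (L := L) (W := W) k N U' u).1 = a := ⟨_, rfl⟩
  obtain ⟨b, hbdef⟩ : ∃ b : ℝ, (sizePair (L := L) (W := W) k N U' u).2 = b := ⟨_, rfl⟩
  rw [hadef] at hX h10 hΦ1
  rw [hbdef] at hh h20 hΦ2
  rw [hadef, hbdef]
  have hMa : (L : ℝ) ^ (k + 1) * a ≤ τ := hΦ1.trans hSτ
  have haS : a ≤ S := (le_mul_of_one_le_left h10 hM1).trans hΦ1
  have ha4 : a ≤ 1 / 10000 := haS.trans hS4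
  have hb4 : b ≤ 1 / 10000 := hΦ2.trans hS4
  have hb2 : b ≤ 1 / 100 := hb4.trans (by norm_num)
  have hX8 : ∀ y κ, ‖repLog W U' u y κ‖ ≤ 1 / 8 := fun y κ => (hX y κ).trans (by linarith)
  have hh8 : ∀ z, ‖cornerLog L k u z‖ ≤ 1 / 8 := fun z => (hh z).trans (by linarith)
  have hDf0 : 0 ≤ sliceDefect hL k hWu hx hs hWx N hθ U' u := sliceDefect_nonneg hL k hWu hx hs hWx N hθ U' u
  obtain ⟨D, hDdef⟩ : ∃ D : ℝ, sliceDefect hL k hWu hx hs hWx N hθ U' u = D := ⟨_, rfl⟩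
  have hD0 : 0 ≤ D := hDdef ▸ hDf0
  have hDmax : D ≤ δmax := hDdef ▸ hDf
  clear hDf hDf0
  have hδ : ∀ y μ, ‖gaugeDir W (gaugeFun hL k hWu hx hs hWx N hθ U' u) y μ‖ ≤ D := fun y μ =>
    hDdef ▸ ((norm_gaugeDir_gaugeFun_le hL k hWu hx hs hWx N hθ U' hWP hU'u hU'P hu huP hgauge hX8 hcorner hh8 y μ).trans
      (delta_le_sliceDefect hL k hWu hx hs hWx N hθ U' u))
  have hσ : ∀ y, ‖gaugeFun hL k hWu hx hs hWx N hθ U' u y‖ ≤ 6 * d * (L : ℝ) ^ (k + 1) * D := fun y => by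
    rw [← hDdef]; exact norm_gaugeFun_le hL k hWu hx hs hWx N hθ U' hWP hU'u hU'P hu huP hgauge hX8 hcorner hh8 hd hθP y
  have hσ0 : 0 ≤ 6 * (d : ℝ) * (L : ℝ) ^ (k + 1) * D := by positivity
  have hσ4 : 6 * (d : ℝ) * (L : ℝ) ^ (k + 1) * D ≤ 1 / 10000 := (mul_le_mul_of_nonneg_left hDmax (by positivity)).trans hδmax
  have hX1 := norm_repLog_sliceStep_le hL k hWu hx hs hWx N hθ U' hgauge hX ha4 hδ hσ hσ4
  have hh1 := norm_cornerLog_sliceStep_le hL k hWu hx hs hWx N hθ U' hcorner hh hb2 hσ hσ4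
  obtain ⟨M, hMdef⟩ : ∃ M : ℝ, (L : ℝ) ^ (k + 1) = M := ⟨_, rfl⟩
  rw [hMdef] at hM1 hMa hσ hσ0 hσ4 hX1 hh1 hδmax hΦ1 ⊢
  have hM0 : 0 < M := by linarith
  have heJ : 16384 * D * a + 2048 * (6 * (d : ℝ) * M * D) * D + 6 * (6 * (d : ℝ) * M * D) * a ≤ 2 * D := by
    have t1 : 16384 * D * a ≤ 16384 * D * (1 / 10000) := mul_le_mul_of_nonneg_left ha4 (by positivity)
    have t2 : (6 * (d : ℝ) * M * D) * D ≤ (1 / 10000) * D := mul_le_mul_of_nonneg_right hσ4 hD0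
    have t3 : 6 * (6 * (d : ℝ) * M * D) * a = 36 * (d : ℝ) * (M * a) * D := by ring
    have t4 : 36 * (d : ℝ) * (M * a) * D ≤ 36 * (d : ℝ) * τ * D := by
      have := mul_le_mul_of_nonneg_left hMa (by positivity : (0:ℝ) ≤ 36 * (d : ℝ) * D); linarith only [this]
    have t5 : (30000 * (d : ℝ) * τ) * D ≤ 1 * D := mul_le_mul_of_nonneg_right hτs hD0
    linarith only [t1, t2, t3, t4, t5, hD0]
  have hdM1 : (1 : ℝ) ≤ (d : ℝ) := hd1
  have hcomp1 : ∀ y κ, ‖repLog W U' (sliceStep hL k hWu hx hs hWx N hθ U' u) y κ‖ ≤ a + 3 * D := fun y κ => by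
    have := hX1 y κ
    linarith only [this, heJ, hD0]
  have hcomp2 : ∀ z, ‖cornerLog L k (sliceStep hL k hWu hx hs hWx N hθ U' u) z‖ ≤ b + 12 * d * M * D := fun z => by
    have := hh1 z
    have t : 4096 * (6 * (d : ℝ) * M * D) * b ≤ (6 * (d : ℝ) * M * D) * (4096 * (1 / 10000)) := by
      have := mul_le_mul_of_nonneg_left hb4 hσ0; linarith only [this]
    linarith only [this, t, hσ0]
  have hfst : (sizePair (L := L) (W := W) k N U' (sliceStep hL k hWu hx hs hWx N hθ U' u)).1 ≤ a + 3 * D :=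
    bondSup_le hP1 (by positivity) hcomp1
  have hsnd : (sizePair (L := L) (W := W) k N U' (sliceStep hL k hWu hx hs hWx N hθ U' u)).2 ≤ b + 12 * d * M * D :=
    siteSup_le hN1 hcomp2
  have hfst0 : 0 ≤ (sizePair (L := L) (W := W) k N U' (sliceStep hL k hWu hx hs hWx N hθ U' u)).1 := bondSup_nonneg fun y μ => norm_nonneg _
  have hsnd0 : 0 ≤ (sizePair (L := L) (W := W) k N U' (sliceStep hL k hWu hx hs hWx N hθ U' u)).2 := siteSup_nonneg fun z => norm_nonneg _
  rw [← hDdef] at hfst hsnd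
  obtain ⟨a1, ha1def⟩ : ∃ a1 : ℝ, (sizePair (L := L) (W := W) k N U' (sliceStep hL k hWu hx hs hWx N hθ U' u)).1 = a1 := ⟨_, rfl⟩
  obtain ⟨b1, hb1def⟩ : ∃ b1 : ℝ, (sizePair (L := L) (W := W) k N U' (sliceStep hL k hWu hx hs hWx N hθ U' u)).2 = b1 := ⟨_, rfl⟩
  rw [ha1def] at hfst hfst0
  rw [hb1def] at hsnd hsnd0
  rw [ha1def, hb1def, hDdef] at *
  rw [hDdef] at hfst hsnd
  have hMfst : M * a1 ≤ M * a + 3 * M * D := by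
    have := mul_le_mul_of_nonneg_left hfst hM0.le; linarith only [this]
  have h3M : 3 * M * D ≤ 12 * d * M * D := by nlinarith [hdM1, hM0.le, hD0]
  have hMa0 : 0 ≤ M * a := mul_nonneg hM0.le h10
  have hMa10 : 0 ≤ M * a1 := mul_nonneg hM0.le hfst0
  rw [Prod.norm_def, Prod.norm_def, Real.norm_of_nonneg hMa10, Real.norm_of_nonneg hsnd0, Real.norm_of_nonneg hMa0, Real.norm_of_nonneg h20]
  exact max_le (by linarith [le_max_left (M * a) b]) (by linarith [le_max_right (M * a) b])

/-! ## §2 The orbit and its limit (k-uniform regime) -/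

include hWP hU'u hU'P in
/-- **THE (S1) ORBIT CONVERGES, k-UNIFORM REGIME**: with the curved sup letter (L) displayed as `hLet` (constant `K`), in the regime `0 ≤ τ ≤ 1`, `30000dτ ≤ 1`,
`3·10⁶(1+16K)(1+d)³(1+frameC)(1+supC+supCurlC)·τ ≤ 1∕2`, `0 ≤ S ≤ 10⁻⁴`, `S ≤ τ`, `6dM·δmax ≤ 10⁻⁴`, `M·δmax ≤ τ`, `M²x, M²x′ ≤ τ` (`M = L^{k+1}`): from a state `u₀` on the
working region (unitary, `(tower)`-periodic, chart, corners) with WEIGHTED sizes `‖(M·sup‖X(u₀)‖, sup‖h(u₀)‖)‖ ≤ s₀`, `Df(u₀) ≤ δ₀ ≤ δmax` and `s₀ + 12dM·δ₀∕(1 − 1∕2) ≤ S`, the orbit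
`u_j := sliceStep^[j] u₀` stays on the region, `Df(u_j) ≤ 2^{−j}δ₀`, `‖(M·sup‖X(u_j)‖, sup‖h(u_j)‖)‖ ≤ s₀ + 12dM·δ₀∕(1 − 1∕2)`, and converges sitewise to a unitary
`(tower)`-periodic `u⋆` with `‖u_j(y) − u⋆(y)‖ ≤ 12dM·δ₀·2^{−j}∕(1 − 1∕2)`.  Every currency (`s₀`, `M·δ₀`, `S`, `τ`) is k-free for the near-representative. [folklore] -/
theorem slice_orbit_w (hd : 0 < d)
    (hθP : 4 * (d : ℝ) ^ 2 * ((L : ℝ) ^ (k + 1) - 1) ^ 2 * x + 16 * d * loopRad d L ((prop1Radius d L)^[k] x)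
      + 4 * d * ((d : ℝ) - 1) * ((L : ℝ) ^ (k + 1) - 1) ^ 2 * x ≤ 1 / 2)
    {K : ℝ} (hK : 0 ≤ K) (hKε : 16 * K * d * (((L : ℝ) ^ (k + 1)) ^ 2 * x) ≤ 1 / 2)
    (hLet : ∀ Y : Site d → Fin d → Matrix n n ℂ, Y ∈ energyBlockLandauW (d := d) (n := n) L N (k + 1) W →
      ∀ B : ℝ, (∀ (z : Site d) (μ ν : Fin d), μ ≠ ν → ‖curlAt W Y z μ ν‖ ≤ B) → ∀ (y : Site d) (κ : Fin d), ‖Y y κ‖ ≤ K * (L : ℝ) ^ (k + 1) * B)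
    (hε : ((L : ℝ) ^ (k + 1)) ^ 2 * x ≤ 1) (hA : curvSum d L (k + 1) x ≤ 2 / 3 * L) (hθc : cruxC d L * (((L : ℝ) ^ (k + 1)) ^ 2 * x) ≤ 1 / 2)
    {x' : ℝ} (hx'0 : 0 ≤ x') (hU'x : SmallField U' x')
    {τ S δmax : ℝ} (hτ0 : 0 ≤ τ) (hτ1 : τ ≤ 1) (hτs : 30000 * (d : ℝ) * τ ≤ 1)
    (hC : 3000000 * (1 + 16 * K) * (1 + (d : ℝ)) ^ 3 * (1 + frameC d L) * (1 + supC d L + supCurlC d L) * τ ≤ 1 / 2)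
    (hS4 : S ≤ 1 / 10000) (hSτ : S ≤ τ)
    (hδmax : 6 * (d : ℝ) * (L : ℝ) ^ (k + 1) * δmax ≤ 1 / 10000) (hMδ : (L : ℝ) ^ (k + 1) * δmax ≤ τ)
    (h4 : ((L : ℝ) ^ (k + 1)) ^ 2 * x ≤ τ) (h5 : ((L : ℝ) ^ (k + 1)) ^ 2 * x' ≤ τ)
    {u₀ : Site d → (Matrix n n ℂ)ˣ} (hu₀ : IsUnitarySite u₀) (hu₀P : IsPeriodicSite u₀ ((tower L N (k + 1) : ℕ) : ℤ))
    (hgauge₀ : gaugeAct u₀ U' = vary W (repLog W U' u₀) 1)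
    (hcorner₀ : ∀ z, ((u₀ (((L : ℤ) ^ (k + 1)) • z) : (Matrix n n ℂ)ˣ) : Matrix n n ℂ) = exp (cornerLog L k u₀ z))
    {s₀ δ₀ : ℝ} (hδ₀ : 0 ≤ δ₀) (hδ₀max : δ₀ ≤ δmax)
    (hs₀ : ‖((L : ℝ) ^ (k + 1) * (sizePair (L := L) (W := W) k N U' u₀).1, (sizePair (L := L) (W := W) k N U' u₀).2)‖ ≤ s₀)
    (hd₀ : sliceDefect hL k hWu hx hs hWx N hθ U' u₀ ≤ δ₀)
    (hSsum : s₀ + 12 * d * (L : ℝ) ^ (k + 1) * δ₀ / (1 - 1 / 2) ≤ S) :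
    ∃ ustar : Site d → (Matrix n n ℂ)ˣ, IsUnitarySite ustar ∧ IsPeriodicSite ustar ((tower L N (k + 1) : ℕ) : ℤ) ∧
      (∀ y, Tendsto (fun j => (((sliceStep hL k hWu hx hs hWx N hθ U')^[j] u₀ y : (Matrix n n ℂ)ˣ) : Matrix n n ℂ)) atTop (𝓝 ((ustar y : (Matrix n n ℂ)ˣ) : Matrix n n ℂ))) ∧
      (∀ (y : Site d) (j : ℕ), ‖(((sliceStep hL k hWu hx hs hWx N hθ U')^[j] u₀ y : (Matrix n n ℂ)ˣ) : Matrix n n ℂ) - ((ustar y : (Matrix n n ℂ)ˣ) : Matrix n n ℂ)‖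
        ≤ 12 * d * (L : ℝ) ^ (k + 1) * δ₀ * (1 / 2) ^ j / (1 - 1 / 2)) ∧
      ∀ j, (IsUnitarySite ((sliceStep hL k hWu hx hs hWx N hθ U')^[j] u₀) ∧ IsPeriodicSite ((sliceStep hL k hWu hx hs hWx N hθ U')^[j] u₀) ((tower L N (k + 1) : ℕ) : ℤ) ∧
          gaugeAct ((sliceStep hL k hWu hx hs hWx N hθ U')^[j] u₀) U' = vary W (repLog W U' ((sliceStep hL k hWu hx hs hWx N hθ U')^[j] u₀)) 1 ∧
          (∀ z, ((((sliceStep hL k hWu hx hs hWx N hθ U')^[j] u₀) (((L : ℤ) ^ (k + 1)) • z) : (Matrix n n ℂ)ˣ) : Matrix n n ℂ)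
            = exp (cornerLog L k ((sliceStep hL k hWu hx hs hWx N hθ U')^[j] u₀) z)) ∧
          sliceDefect hL k hWu hx hs hWx N hθ U' ((sliceStep hL k hWu hx hs hWx N hθ U')^[j] u₀) ≤ δmax) ∧
        sliceDefect hL k hWu hx hs hWx N hθ U' ((sliceStep hL k hWu hx hs hWx N hθ U')^[j] u₀) ≤ (1 / 2) ^ j * δ₀ ∧
        ‖((L : ℝ) ^ (k + 1) * (sizePair (L := L) (W := W) k N U' ((sliceStep hL k hWu hx hs hWx N hθ U')^[j] u₀)).1,
            (sizePair (L := L) (W := W) k N U' ((sliceStep hL k hWu hx hs hWx N hθ U')^[j] u₀)).2)‖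
          ≤ s₀ + 12 * d * (L : ℝ) ^ (k + 1) * δ₀ / (1 - 1 / 2) := by
  have hM0 : 0 < (L : ℝ) ^ (k + 1) := by positivity
  have hM1 : (1 : ℝ) ≤ (L : ℝ) ^ (k + 1) := one_le_pow₀ (by exact_mod_cast (by omega : 1 ≤ L))
  have hreg : ∀ u : Site d → (Matrix n n ℂ)ˣ, IsPeriodicSite u ((tower L N (k + 1) : ℕ) : ℤ) →
      ‖((L : ℝ) ^ (k + 1) * (sizePair (L := L) (W := W) k N U' u).1, (sizePair (L := L) (W := W) k N U' u).2)‖ ≤ S →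
      (L : ℝ) ^ (k + 1) * (sizePair (L := L) (W := W) k N U' u).1 ≤ S ∧ (sizePair (L := L) (W := W) k N U' u).2 ≤ S ∧
      (∀ y κ, ‖repLog W U' u y κ‖ ≤ S) ∧ (∀ z, ‖cornerLog L k u z‖ ≤ S) := fun u huP hΦ => by
    obtain ⟨hX, hh, -, -, -, -⟩ := region_sizes hL k N U' hWP hU'P huP
    obtain ⟨h1, h1', h2⟩ := weighted_region hL k N U' hΦ
    exact ⟨h1, h2, fun y κ => (hX y κ).trans h1', fun z => (hh z).trans h2⟩
  have hgf : ∀ u : Site d → (Matrix n n ℂ)ˣ, IsUnitarySite u → IsPeriodicSite u ((tower L N (k + 1) : ℕ) : ℤ) → gaugeAct u U' = vary W (repLog W U' u) 1 →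
      (∀ z, ((u (((L : ℤ) ^ (k + 1)) • z) : (Matrix n n ℂ)ˣ) : Matrix n n ℂ) = exp (cornerLog L k u z)) → sliceDefect hL k hWu hx hs hWx N hθ U' u ≤ δmax →
      ‖((L : ℝ) ^ (k + 1) * (sizePair (L := L) (W := W) k N U' u).1, (sizePair (L := L) (W := W) k N U' u).2)‖ ≤ S →
      (∀ y, ‖gaugeFun hL k hWu hx hs hWx N hθ U' u y‖ ≤ 6 * d * (L : ℝ) ^ (k + 1) * sliceDefect hL k hWu hx hs hWx N hθ U' u) ∧
        6 * (d : ℝ) * (L : ℝ) ^ (k + 1) * sliceDefect hL k hWu hx hs hWx N hθ U' u ≤ 1 / 10000 := fun u hu huP hgauge hcorner hDf hΦ => by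
    obtain ⟨-, -, hXs, hhs⟩ := hreg u huP hΦ
    have hX8 : ∀ y κ, ‖repLog W U' u y κ‖ ≤ 1 / 8 := fun y κ => (hXs y κ).trans (by linarith)
    have hh8 : ∀ z, ‖cornerLog L k u z‖ ≤ 1 / 8 := fun z => (hhs z).trans (by linarith)
    exact ⟨norm_gaugeFun_le hL k hWu hx hs hWx N hθ U' hWP hU'u hU'P hu huP hgauge hX8 hcorner hh8 hd hθP,
      (mul_le_mul_of_nonneg_left hDf (by positivity)).trans hδmax⟩
  have hS2 : S ≤ 1 / 100 := hS4.trans (by norm_num)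
  have hmaps : ∀ u ∈ {u : Site d → (Matrix n n ℂ)ˣ | IsUnitarySite u ∧ IsPeriodicSite u ((tower L N (k + 1) : ℕ) : ℤ) ∧ gaugeAct u U' = vary W (repLog W U' u) 1 ∧
      (∀ z, ((u (((L : ℤ) ^ (k + 1)) • z) : (Matrix n n ℂ)ˣ) : Matrix n n ℂ) = exp (cornerLog L k u z)) ∧ sliceDefect hL k hWu hx hs hWx N hθ U' u ≤ δmax},
      ‖((L : ℝ) ^ (k + 1) * (sizePair (L := L) (W := W) k N U' u).1, (sizePair (L := L) (W := W) k N U' u).2)‖ ≤ S →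
      sliceStep hL k hWu hx hs hWx N hθ U' u ∈ {u : Site d → (Matrix n n ℂ)ˣ | IsUnitarySite u ∧ IsPeriodicSite u ((tower L N (k + 1) : ℕ) : ℤ) ∧
        gaugeAct u U' = vary W (repLog W U' u) 1 ∧ (∀ z, ((u (((L : ℤ) ^ (k + 1)) • z) : (Matrix n n ℂ)ˣ) : Matrix n n ℂ) = exp (cornerLog L k u z)) ∧
        sliceDefect hL k hWu hx hs hWx N hθ U' u ≤ δmax} := by
    rintro u ⟨hu, huP, hgauge, hcorner, hDf⟩ hΦ
    obtain ⟨hΦ1, hΦ2, hXs, hhs⟩ := hreg u huP hΦ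
    obtain ⟨hσ, hσ4⟩ := hgf u hu huP hgauge hcorner hDf hΦ
    have hhalf := step_halves_defect_w hL k hWu hx hs hWx N hθ U' hWP hU'u hU'P hd hθP hK hKε hLet hε hA hθc hx'0 hU'x hτ0 hτ1 hτs hC hS4 hSτ hδmax hMδ h4 h5
      hu huP hgauge hcorner hDf hΦ1 hΦ2
    have hDf0 := sliceDefect_nonneg hL k hWu hx hs hWx N hθ U' u
    exact ⟨sliceStep_unitary hL k hWu hx hs hWx N hθ U' hWP hU'u hU'P hu huP hgauge hcorner hXs hS4 hhs hS2,
      sliceStep_periodic hL k hWu hx hs hWx N hθ U' hWP hU'u hU'P hu huP hgauge hcorner hXs hS4 hhs hS2,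
      sliceStep_chart hL k hWu hx hs hWx N hθ U' hgauge hXs hS4 hσ hσ4,
      sliceStep_corner hL k hWu hx hs hWx N hθ U' hcorner hhs hS2 hσ hσ4,
      hhalf.trans (by linarith)⟩
  have hcontr : ∀ u ∈ {u : Site d → (Matrix n n ℂ)ˣ | IsUnitarySite u ∧ IsPeriodicSite u ((tower L N (k + 1) : ℕ) : ℤ) ∧ gaugeAct u U' = vary W (repLog W U' u) 1 ∧
      (∀ z, ((u (((L : ℤ) ^ (k + 1)) • z) : (Matrix n n ℂ)ˣ) : Matrix n n ℂ) = exp (cornerLog L k u z)) ∧ sliceDefect hL k hWu hx hs hWx N hθ U' u ≤ δmax},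
      ‖((L : ℝ) ^ (k + 1) * (sizePair (L := L) (W := W) k N U' u).1, (sizePair (L := L) (W := W) k N U' u).2)‖ ≤ S →
      sliceDefect hL k hWu hx hs hWx N hθ U' (sliceStep hL k hWu hx hs hWx N hθ U' u) ≤ 1 / 2 * sliceDefect hL k hWu hx hs hWx N hθ U' u := by
    rintro u ⟨hu, huP, hgauge, hcorner, hDf⟩ hΦ
    obtain ⟨hΦ1, hΦ2, -, -⟩ := hreg u huP hΦ
    have hhalf := step_halves_defect_w hL k hWu hx hs hWx N hθ U' hWP hU'u hU'P hd hθP hK hKε hLet hε hA hθc hx'0 hU'x hτ0 hτ1 hτs hC hS4 hSτ hδmax hMδ h4 h5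
      hu huP hgauge hcorner hDf hΦ1 hΦ2
    linarith
  have hgrow : ∀ u ∈ {u : Site d → (Matrix n n ℂ)ˣ | IsUnitarySite u ∧ IsPeriodicSite u ((tower L N (k + 1) : ℕ) : ℤ) ∧ gaugeAct u U' = vary W (repLog W U' u) 1 ∧
      (∀ z, ((u (((L : ℤ) ^ (k + 1)) • z) : (Matrix n n ℂ)ˣ) : Matrix n n ℂ) = exp (cornerLog L k u z)) ∧ sliceDefect hL k hWu hx hs hWx N hθ U' u ≤ δmax},
      ‖((L : ℝ) ^ (k + 1) * (sizePair (L := L) (W := W) k N U' u).1, (sizePair (L := L) (W := W) k N U' u).2)‖ ≤ S →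
      ‖((L : ℝ) ^ (k + 1) * (sizePair (L := L) (W := W) k N U' (sliceStep hL k hWu hx hs hWx N hθ U' u)).1,
          (sizePair (L := L) (W := W) k N U' (sliceStep hL k hWu hx hs hWx N hθ U' u)).2)‖
        ≤ ‖((L : ℝ) ^ (k + 1) * (sizePair (L := L) (W := W) k N U' u).1, (sizePair (L := L) (W := W) k N U' u).2)‖
          + 12 * d * (L : ℝ) ^ (k + 1) * sliceDefect hL k hWu hx hs hWx N hθ U' u := by
    rintro u ⟨hu, huP, hgauge, hcorner, hDf⟩ hΦ
    obtain ⟨hΦ1, hΦ2, -, -⟩ := hreg u huP hΦ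
    exact step_sizes_le_w hL k hWu hx hs hWx N hθ U' hWP hU'u hU'P hd hθP hτs hS4 hSτ hδmax hu huP hgauge hcorner hDf hΦ1 hΦ2
  have hdisp : ∀ u ∈ {u : Site d → (Matrix n n ℂ)ˣ | IsUnitarySite u ∧ IsPeriodicSite u ((tower L N (k + 1) : ℕ) : ℤ) ∧ gaugeAct u U' = vary W (repLog W U' u) 1 ∧
      (∀ z, ((u (((L : ℤ) ^ (k + 1)) • z) : (Matrix n n ℂ)ˣ) : Matrix n n ℂ) = exp (cornerLog L k u z)) ∧ sliceDefect hL k hWu hx hs hWx N hθ U' u ≤ δmax},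
      ‖((L : ℝ) ^ (k + 1) * (sizePair (L := L) (W := W) k N U' u).1, (sizePair (L := L) (W := W) k N U' u).2)‖ ≤ S →
      ∀ y : Site d, ‖((sliceStep hL k hWu hx hs hWx N hθ U' u y : (Matrix n n ℂ)ˣ) : Matrix n n ℂ) - ((u y : (Matrix n n ℂ)ˣ) : Matrix n n ℂ)‖
        ≤ 12 * d * (L : ℝ) ^ (k + 1) * sliceDefect hL k hWu hx hs hWx N hθ U' u := by
    rintro u ⟨hu, huP, hgauge, hcorner, hDf⟩ hΦ y
    obtain ⟨hσ, hσ4⟩ := hgf u hu huP hgauge hcorner hDf hΦ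
    have h := norm_sliceStep_sub_le hL k hWu hx hs hWx N hθ U' hu hσ hσ4 y
    linarith
  obtain ⟨v, hv, htail, horbit⟩ := exists_orbit_limit
    (K := {u : Site d → (Matrix n n ℂ)ˣ | IsUnitarySite u ∧ IsPeriodicSite u ((tower L N (k + 1) : ℕ) : ℤ) ∧ gaugeAct u U' = vary W (repLog W U' u) 1 ∧
      (∀ z, ((u (((L : ℤ) ^ (k + 1)) • z) : (Matrix n n ℂ)ˣ) : Matrix n n ℂ) = exp (cornerLog L k u z)) ∧ sliceDefect hL k hWu hx hs hWx N hθ U' u ≤ δmax})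
    (step := sliceStep hL k hWu hx hs hWx N hθ U')
    (Φ := fun u => ((L : ℝ) ^ (k + 1) * (sizePair (L := L) (W := W) k N U' u).1, (sizePair (L := L) (W := W) k N U' u).2))
    (Df := sliceDefect hL k hWu hx hs hWx N hθ U')
    (ev := fun (u : Site d → (Matrix n n ℂ)ˣ) (y : Site d) => ((u y : (Matrix n n ℂ)ˣ) : Matrix n n ℂ))
    (θ := 1 / 2) (A := 12 * d * (L : ℝ) ^ (k + 1)) (B := 12 * d * (L : ℝ) ^ (k + 1)) (S := S) (s₀ := s₀) (δ₀ := δ₀) (u₀ := u₀)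
    (by norm_num) (by norm_num) (by positivity) hδ₀ hSsum hmaps hcontr hgrow (by positivity) hdisp ⟨hu₀, hu₀P, hgauge₀, hcorner₀, hd₀.trans hδ₀max⟩ hs₀ hd₀
  have hvu : ∀ y, v y ∈ unitary (Matrix n n ℂ) := mem_unitary_of_tendsto (fun j => (horbit j).1.1) hv
  refine ⟨fun y => Unitary.toUnits ⟨v y, hvu y⟩, fun y => mem_unitaryUnits.mpr (hvu y), fun y i => ?_, fun y => hv y, fun y j => ?_,
    fun j => ⟨(horbit j).1, (horbit j).2.1, (horbit j).2.2⟩⟩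
  · exact Units.ext (periodic_of_tendsto (fun j => (horbit j).1.2.1) hv y i)
  · have h := htail y j
    rwa [dist_eq_norm] at h

end Orbit

end

end Summit.QuantumFields.BalabanUV.T4Continuum.NE7SliceIterationOrbitWeighted
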